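import Literature.Geometry.Lorentzian.DevelopmentGluingMetric
import Literature.Geometry.Lorentzian.DataEmbeddingNormalSmooth
import Summits.FinalStateConjecture.FinalStateConjecture.Theorems.SwallowTheDatumSubdataDevelopmentsEmbedMCGHD

/-!
# Route SwallowTheDatum · item `SubdataDevelopmentsEmbed` (stmt-FinalStateConjecture-10053) —
# the RELATIVE gluing, I: the glued space `M' ∪_U M` of a relative common sub-development and
# its Hausdorff property (relative form of Sbierski 2016, §3.3, proof of Thm. 5)

Setting (as in `…SubdataDevelopmentsEmbedMCGHD.lean`, `…Hmax.lean`): `𝒟'` is a Cauchy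
development of data `D₁` on `N`, `𝒟` one of data `D₂` on `X`, `Φ : N → X` injective, and
`(U, ψ)` — `U ⊆ M'` open and connected containing `ι'(N)`, with `ι'(N)` a Cauchy hypersurface of
the open sub-spacetime `U`, and `ψ : M' → M` smooth, isometric and time-orientation preserving ON
`U` with `ψ ∘ ι' = ι ∘ Φ` — a relative common sub-development over `Φ`. The tree glues two
developments OF THE SAME DATA along a common development (`Literature/…/DevelopmentGluing*.lean`,
over the general pushout `Literature.Topology.FourManifolds.SmoothGlueData`); the hypothesis
`hglue` of `top_of_maximal_relCGHD` (`…Hmax.lean`) asks for the relative version, where `U ⊆ M'`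
develops the SUB-data and `ψ` lands in a development of the full data. This file and its sequels
carry out the relative construction in definition-free form (every object is produced
existentially over `SmoothGlueData`, so that no new definition enters the tree):

* `glueMap_isIsometricImmersion` — `ψ|_U : (U, g'|_U, τ'|_U) → (M, g, τ)` is a time-orientation
  preserving isometric immersion over `Φ`, hence (relative Lemma 3.2 of Sbierski,
  `isOpenEmbedding_of_isIsometricImmersion_rel` applied to the restricted development
  `𝒟'.restrict U`) injective, an open embedding and a local diffeomorphism;
* `exists_glueData` — **the gluing datum**: a `SmoothGlueData` `d` on `(M', M)` whose gluing
  partial diffeomorphism has source `U` and equals `ψ` there (so `d.Glued = M' ⊔ M / (p ∼ ψ p)`,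
  `d.inl = π ∘ j' : M' → M̃`, `d.inr = π ∘ j : M → M̃`);
* `isClosed_graph_of_ncb` / `t2Space_glued_of_ncb` — **without corresponding boundary points the
  glued space is Hausdorff**: if no `q ∈ M` is a cluster point of `ψ` along `U` at a point of
  `∂U` (the hypothesis `hncb` of `top_of_maximal_relCGHD`, Sbierski 2016, Def. 11), the graph of
  the gluing map is closed, and `SmoothGlueData.t2Space_of_isClosed_graph` applies.

No definition, no named fact; pure port of `DevelopmentGluingData.lean` to the relative datum.
-/

noncomputable section

open Function Set Filter Topology TopologicalSpace Bundle Manifold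
open scoped Manifold ContDiff Topology
open Literature.Topology.FourManifolds

namespace Summit.FinalStateConjecture.FinalStateConjecture.Theorems

namespace SubdataDevelopmentsEmbed

open Literature.Geometry.Lorentzian

universe u

variable {n : ℕ}
  {N : Type u} [TopologicalSpace N] [ChartedSpace (EuclideanSpace ℝ (Fin n)) N]
  [IsManifold (𝓡 n) ∞ N] [ConnectedSpace N] {D₁ : InitialDataSet (𝓡 n) N}
  {X : Type u} [TopologicalSpace X] [ChartedSpace (EuclideanSpace ℝ (Fin n)) X]
  [IsManifold (𝓡 n) ∞ X] [ConnectedSpace X] {D₂ : InitialDataSet (𝓡 n) X}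

/-! ### The gluing map `ψ|_U` -/

/-- The differential of `ψ ∘ Subtype.val : U → M` at `y ∈ U` is that of `ψ`, for `ψ` smooth on
the open set `U`. -/
theorem mfderiv_comp_subtypeVal_of_contMDiffOn {𝒟' : CauchyDevelopment D₁}
    {𝒟 : CauchyDevelopment D₂} {U : Opens 𝒟'.carrier} {ψ : 𝒟'.carrier → 𝒟.carrier}
    (hs : ContMDiffOn (𝓡 (n + 1)) (𝓡 (n + 1)) ∞ ψ U) (y : U) (v : TangentSpace (𝓡 (n + 1)) y) :
    mfderiv (𝓡 (n + 1)) (𝓡 (n + 1)) (ψ ∘ (Subtype.val : U → 𝒟'.carrier)) y v =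
      mfderiv (𝓡 (n + 1)) (𝓡 (n + 1)) ψ y.1 v := by
  have hd : MDifferentiableAt (𝓡 (n + 1)) (𝓡 (n + 1)) ψ y.1 :=
    ((hs y.1 y.2).contMDiffAt (U.2.mem_nhds y.2)).mdifferentiableAt (by simp)
  rw [mfderiv_comp y hd
    (hasMFDerivAt_subtypeVal (I' := 𝓡 (n + 1)) (W := U) y).mdifferentiableAt, mfderiv_subtypeVal]
  rfl

/-- **`ψ|_U` is a time-orientation preserving isometric immersion of the open sub-spacetime
`(U, g'|_U, τ'|_U)` into `(M, g, τ)`** (unbundling of the displayed conditions "smooth,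
isometric, time-orientation preserving on `U`"). -/
theorem glueMap_isIsometricImmersion (𝒟' : CauchyDevelopment D₁) (𝒟 : CauchyDevelopment D₂)
    {U : Opens 𝒟'.carrier} {ψ : 𝒟'.carrier → 𝒟.carrier}
    (hs : ContMDiffOn (𝓡 (n + 1)) (𝓡 (n + 1)) ∞ ψ U)
    (hi : ∀ p ∈ U, pullbackBilin (I := 𝓡 (n + 1)) (I' := 𝓡 (n + 1)) ψ 𝒟.metric.val p =
        𝒟'.metric.val p)
    (ht : ∀ p ∈ U, 𝒟.timeOrientation.IsFutureDirected
        (mfderiv (𝓡 (n + 1)) (𝓡 (n + 1)) ψ p (𝒟'.timeOrientation.vectorField p))) :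
    (𝒟'.metric.restrict PseudoRiemannianMetric.contMDiff_restrict_holds U).IsIsometricImmersion
        𝒟.metric.toPseudoRiemannianMetric (ψ ∘ (Subtype.val : U → 𝒟'.carrier)) ∧
      (𝒟'.timeOrientation.restrict PseudoRiemannianMetric.contMDiff_restrict_holds
        𝒟'.timeOrientation.contMDiff_restrict_holds U).PreservesTimeOrientation
          (ψ ∘ (Subtype.val : U → 𝒟'.carrier)) 𝒟.timeOrientation := by
  have hsmooth : ContMDiff (𝓡 (n + 1)) (𝓡 (n + 1)) ∞ (ψ ∘ (Subtype.val : U → 𝒟'.carrier)) :=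
    hs.comp_contMDiff contMDiff_subtype_val fun p ↦ p.2
  refine ⟨⟨hsmooth, fun (y : U) ↦ ?_⟩, fun y ↦ ?_⟩
  · ext v w
    have hk := congrArg (fun b ↦ b v w) (hi y.1 y.2)
    simp only [pullbackBilin_apply] at hk
    change 𝒟.metric.val (ψ y.1)
        (mfderiv (𝓡 (n + 1)) (𝓡 (n + 1)) (ψ ∘ (Subtype.val : U → 𝒟'.carrier)) y v)
        (mfderiv (𝓡 (n + 1)) (𝓡 (n + 1)) (ψ ∘ (Subtype.val : U → 𝒟'.carrier)) y w) =
      𝒟'.metric.val y.1 v w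
    rw [mfderiv_comp_subtypeVal_of_contMDiffOn hs y v, mfderiv_comp_subtypeVal_of_contMDiffOn hs y w]
    exact hk
  · change 𝒟.timeOrientation.IsFutureDirected
      (mfderiv (𝓡 (n + 1)) (𝓡 (n + 1)) (ψ ∘ (Subtype.val : U → 𝒟'.carrier)) y
        (𝒟'.timeOrientation.vectorField y.1))
    rw [mfderiv_comp_subtypeVal_of_contMDiffOn hs]
    exact ht y.1 y.2

/-- **`ψ|_U` is injective, an open embedding and a local diffeomorphism** (relative Lemma 3.2 of
Sbierski 2016 = `isOpenEmbedding_of_isIsometricImmersion_rel`, applied to the restricted Cauchy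
development `(U, g'|_U, τ'|_U, ι', ν')` = `𝒟'.restrict U`, whose hypothesis `hν` is the theorem
`DataEmbedding.mdifferentiableAt_embed_normal`; the local-diffeomorphism clause is
`LorentzianMetric.isLocalDiffeomorph_of_isIsometricImmersion`). -/
theorem glueMap_isOpenEmbedding (𝒟' : CauchyDevelopment D₁) (𝒟 : CauchyDevelopment D₂)
    {Φ : N → X} (hΦ : Injective Φ) {U : Opens 𝒟'.carrier} {ψ : 𝒟'.carrier → 𝒟.carrier}
    (hι : ∀ u, 𝒟'.embed u ∈ U) (hU : IsConnected (U : Set 𝒟'.carrier))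
    (hC : (𝒟'.metric.restrict PseudoRiemannianMetric.contMDiff_restrict_holds U).IsCauchyHypersurface
        (𝒟'.timeOrientation.restrict PseudoRiemannianMetric.contMDiff_restrict_holds
          𝒟'.timeOrientation.contMDiff_restrict_holds U) (Subtype.val ⁻¹' range 𝒟'.embed))
    (hs : ContMDiffOn (𝓡 (n + 1)) (𝓡 (n + 1)) ∞ ψ U)
    (hi : ∀ p ∈ U, pullbackBilin (I := 𝓡 (n + 1)) (I' := 𝓡 (n + 1)) ψ 𝒟.metric.val p =
        𝒟'.metric.val p)
    (ht : ∀ p ∈ U, 𝒟.timeOrientation.IsFutureDirected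
        (mfderiv (𝓡 (n + 1)) (𝓡 (n + 1)) ψ p (𝒟'.timeOrientation.vectorField p)))
    (hc : ψ ∘ 𝒟'.embed = 𝒟.embed ∘ Φ) :
    Injective (ψ ∘ (Subtype.val : U → 𝒟'.carrier)) ∧
      IsOpenEmbedding (ψ ∘ (Subtype.val : U → 𝒟'.carrier)) ∧
      IsLocalDiffeomorph (𝓡 (n + 1)) (𝓡 (n + 1)) ∞ (ψ ∘ (Subtype.val : U → 𝒟'.carrier)) := by
  have hν : ∀ x, MDifferentiableAt (𝓡 n) (𝓡 (n + 1)).tangent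
      (fun x ↦ (TotalSpace.mk' (EuclideanSpace ℝ (Fin (n + 1))) (𝒟'.embed x) (𝒟'.normal x) :
        TangentBundle (𝓡 (n + 1)) 𝒟'.carrier)) x := fun x ↦
    𝒟'.toDataEmbedding.mdifferentiableAt_embed_normal x
  -- the Cauchy hypersurface of the restriction, in the form `restrict` wants
  have hrange : range (𝒟'.embedOpens U hι) = Subtype.val ⁻¹' range 𝒟'.embed := by
    ext p
    constructor
    · rintro ⟨u, rfl⟩; exact ⟨u, rfl⟩
    · rintro ⟨u, hu⟩; exact ⟨u, Subtype.ext hu⟩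
  have hC' : (𝒟'.metric.restrict PseudoRiemannianMetric.contMDiff_restrict_holds U).IsCauchyHypersurface
      (𝒟'.timeOrientation.restrict PseudoRiemannianMetric.contMDiff_restrict_holds
        𝒟'.timeOrientation.contMDiff_restrict_holds U) (range (𝒟'.embedOpens U hι)) := by
    rw [hrange]; exact hC
  obtain ⟨hiso, hτ⟩ := glueMap_isIsometricImmersion 𝒟' 𝒟 hs hi ht
  obtain ⟨-, hopen, -⟩ :=
    isOpenEmbedding_of_isIsometricImmersion_rel (𝒟'.restrict U hU hι hν hC') 𝒟 hiso hτ hΦ hc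
  exact ⟨hopen.injective, hopen,
    LorentzianMetric.isLocalDiffeomorph_of_isIsometricImmersion hiso⟩

/-! ### The gluing datum -/

/-- **The gluing datum of a relative common sub-development.** There is a smooth gluing datum
`d` on `(M', M)` (`Literature.Topology.FourManifolds.SmoothGlueData`, model `ℝ^{n+1}` on both
sides) whose gluing partial diffeomorphism `M' ⇀ M` has source exactly `U` and equals `ψ` on `U`:
the inverse of the inclusion `U ↪ M'` followed by the open embedding `ψ|_U` (as in
`CauchyDevelopment.CommonDevelopment.glue`/`glueData`), smooth on `U` and with smooth inverse
on `ψ(U)` (near `ψ y` the inverse is the inclusion composed with a local inverse of the local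
diffeomorphism `ψ|_U`). Its glued space `d.Glued = (M' ⊔ M)/(p ∼ ψ p)` is the relative
`M' ∪_U M` with pieces `d.inl = π ∘ j' : M' → M̃`, `d.inr = π ∘ j : M → M̃`. Relative form of
Sbierski 2016, §3.3, first step of the proof of Thm. 5. -/
theorem exists_glueData (𝒟' : CauchyDevelopment D₁) (𝒟 : CauchyDevelopment D₂)
    {Φ : N → X} (hΦ : Injective Φ) {U : Opens 𝒟'.carrier} {ψ : 𝒟'.carrier → 𝒟.carrier}
    (hι : ∀ u, 𝒟'.embed u ∈ U) (hU : IsConnected (U : Set 𝒟'.carrier))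
    (hC : (𝒟'.metric.restrict PseudoRiemannianMetric.contMDiff_restrict_holds U).IsCauchyHypersurface
        (𝒟'.timeOrientation.restrict PseudoRiemannianMetric.contMDiff_restrict_holds
          𝒟'.timeOrientation.contMDiff_restrict_holds U) (Subtype.val ⁻¹' range 𝒟'.embed))
    (hs : ContMDiffOn (𝓡 (n + 1)) (𝓡 (n + 1)) ∞ ψ U)
    (hi : ∀ p ∈ U, pullbackBilin (I := 𝓡 (n + 1)) (I' := 𝓡 (n + 1)) ψ 𝒟.metric.val p =
        𝒟'.metric.val p)
    (ht : ∀ p ∈ U, 𝒟.timeOrientation.IsFutureDirected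
        (mfderiv (𝓡 (n + 1)) (𝓡 (n + 1)) ψ p (𝒟'.timeOrientation.vectorField p)))
    (hc : ψ ∘ 𝒟'.embed = 𝒟.embed ∘ Φ) :
    ∃ d : SmoothGlueData (𝓡 (n + 1)) (𝓡 (n + 1)) 𝒟'.carrier 𝒟.carrier
        (EuclideanSpace ℝ (Fin (n + 1))),
      d.glue.source = (U : Set 𝒟'.carrier) ∧ ∀ p (hp : p ∈ U), d.glue p = ψ p := by
  obtain ⟨x₀⟩ : Nonempty N := inferInstance
  have hne : Nonempty U := ⟨𝒟'.embedOpens U hι x₀⟩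
  obtain ⟨-, hopen, hloc⟩ := glueMap_isOpenEmbedding 𝒟' 𝒟 hΦ hι hU hC hs hi ht hc
  set map : U → 𝒟.carrier := ψ ∘ (Subtype.val : U → 𝒟'.carrier) with hmap
  -- the gluing partial homeomorphism
  set e : OpenPartialHomeomorph 𝒟'.carrier 𝒟.carrier :=
    (U.openPartialHomeomorphSubtypeCoe hne).symm.trans (hopen.toOpenPartialHomeomorph map) with he
  have hsrc : e.source = (U : Set 𝒟'.carrier) := by simp [he]
  have htgt : e.target = range map := by simp [he]
  have hcoe : ∀ {p : 𝒟'.carrier} (hp : p ∈ U),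
      (U.openPartialHomeomorphSubtypeCoe hne).symm p = ⟨p, hp⟩ := fun {p} hp ↦ by
    have h := (U.openPartialHomeomorphSubtypeCoe hne).left_inv (x := ⟨p, hp⟩) (by simp)
    simpa using h
  have happly : ∀ {p : 𝒟'.carrier} (hp : p ∈ U), e p = ψ p := fun {p} hp ↦ by
    simp [he, hcoe hp, hmap]
  have hsymm : ∀ y : U, e.symm (map y) = y := fun y ↦ by
    have h : e y = map y := happly y.2
    rw [← h]
    exact e.left_inv (by rw [hsrc]; exact y.2)
  -- smoothness of the gluing map on `U`
  have hsm : ContMDiffOn (𝓡 (n + 1)) (𝓡 (n + 1)) ∞ e e.source := by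
    rw [hsrc]
    exact hs.congr fun p hp ↦ happly hp
  -- smoothness of the inverse on `ψ(U)`
  have hsm' : ContMDiffOn (𝓡 (n + 1)) (𝓡 (n + 1)) ∞ e.symm e.target := by
    rw [htgt]
    rintro _ ⟨y, rfl⟩
    obtain ⟨F, hyF, heq⟩ := hloc y
    have hFt : IsOpen F.target := F.open_target
    have hyt : map y ∈ F.target := by rw [heq hyF]; exact F.map_source hyF
    have hev : e.symm =ᶠ[𝓝 (map y)] (Subtype.val ∘ F.symm) := by
      filter_upwards [hFt.mem_nhds hyt] with z hz
      have hw : F.symm z ∈ F.source := F.map_target hz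
      have hz' : z = map (F.symm z) := by rw [heq hw]; exact (F.right_inv hz).symm
      rw [comp_apply, hz', hsymm]
      exact congrArg Subtype.val (by rw [← hz'])
    have hsmF : ContMDiffAt (𝓡 (n + 1)) (𝓡 (n + 1)) ∞ (Subtype.val ∘ F.symm) (map y) :=
      (contMDiff_subtype_val.contMDiffAt).comp _
        (F.contMDiffOn_invFun.contMDiffAt (hFt.mem_nhds hyt))
    exact (hsmF.congr_of_eventuallyEq hev).contMDiffWithinAt
  exact ⟨⟨e, hsm, hsm', ContinuousLinearEquiv.refl ℝ _, ContinuousLinearEquiv.refl ℝ _⟩, hsrc,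
    fun p hp ↦ happly hp⟩

/-! ### The Hausdorff property from the absence of corresponding boundary points -/

/-- **No corresponding boundary points ⇒ the graph of the gluing map is closed.** If no point
`q ∈ M` is a cluster point of `ψ` along `U` at a point of `∂U` (Sbierski 2016, Def. 11 — the
hypothesis `hncb` of `top_of_maximal_relCGHD`), then the graph `{(p, ψ p) | p ∈ U} ⊆ M' × M` is
closed: a point `(p, q)` of its closure has `p ∈ Ū`; if `p ∈ U` then `q = ψ p` by continuity
of `ψ` within `U` at `p` (Hausdorff `M`); if `p ∉ U` then `p ∈ ∂U` and `q` is a cluster point of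
`ψ` along `U` at `p`. Relative form of
`CommonDevelopment.isClosed_graph_iff_not_hasCorrespondingBoundaryPoints` (Sbierski 2016,
§3.3, "this is exactly the statement that there are no corresponding boundary points"). -/
theorem isClosed_graph_of_ncb {𝒟' : CauchyDevelopment D₁} {𝒟 : CauchyDevelopment D₂}
    {U : Opens 𝒟'.carrier} {ψ : 𝒟'.carrier → 𝒟.carrier} (hcont : ContinuousOn ψ U)
    (hncb : ∀ p ∈ frontier (U : Set 𝒟'.carrier), ∀ q : 𝒟.carrier,
      ¬ ClusterPt q (map ψ (𝓝[(U : Set 𝒟'.carrier)] p)))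
    (d : SmoothGlueData (𝓡 (n + 1)) (𝓡 (n + 1)) 𝒟'.carrier 𝒟.carrier
      (EuclideanSpace ℝ (Fin (n + 1))))
    (hsrc : d.glue.source = (U : Set 𝒟'.carrier)) (hglue : ∀ p (hp : p ∈ U), d.glue p = ψ p) :
    IsClosed {q : 𝒟'.carrier × 𝒟.carrier | q.1 ∈ d.glue.source ∧ d.glue q.1 = q.2} := by
  have hgraph : {q : 𝒟'.carrier × 𝒟.carrier | q.1 ∈ d.glue.source ∧ d.glue q.1 = q.2} =
      {q | ∃ hp : q.1 ∈ U, ψ q.1 = q.2} := by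
    ext q
    simp only [mem_setOf_eq, hsrc, SetLike.mem_coe]
    constructor
    · rintro ⟨hp, h⟩; exact ⟨hp, by rw [← hglue _ hp]; exact h⟩
    · rintro ⟨hp, h⟩; exact ⟨hp, by rw [hglue _ hp]; exact h⟩
  rw [hgraph]
  refine isClosed_of_closure_subset fun q hq ↦ ?_
  obtain ⟨p, q⟩ := q
  -- the neighbourhood condition of Def. 11
  have hN : ∀ V ∈ 𝓝 p, ∀ V' ∈ 𝓝 q, ∃ a ∈ U, a ∈ V ∧ ψ a ∈ V' := by
    intro V hV V' hV'
    rw [mem_closure_iff_nhds] at hq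
    obtain ⟨⟨a, b⟩, hab, ha, hmap⟩ := hq (V ×ˢ V') (prod_mem_nhds hV hV')
    exact ⟨a, ha, hab.1, by rw [hmap]; exact hab.2⟩
  by_cases hp : p ∈ U
  · -- `q = ψ p` by continuity of `ψ` within `U` at `p`
    refine ⟨hp, ?_⟩
    by_contra hne
    obtain ⟨W, W', hWo, hW'o, hW, hW', hdisj⟩ := t2_separation hne
    have hcw : ContinuousWithinAt ψ (U : Set 𝒟'.carrier) p := hcont p hp
    have hV : ψ ⁻¹' W ∈ 𝓝[(U : Set 𝒟'.carrier)] p := hcw.preimage_mem_nhdsWithin (hWo.mem_nhds hW)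
    obtain ⟨V, hV, hVU⟩ := mem_nhdsWithin_iff_exists_mem_nhds_inter.1 hV
    obtain ⟨a, haU, haV, haW'⟩ := hN V hV W' (hW'o.mem_nhds hW')
    exact Set.disjoint_left.1 hdisj (hVU ⟨haV, haU⟩) haW'
  · -- `p ∈ ∂U` and `q` is a cluster point of `ψ` along `U` at `p`
    exfalso
    have hpcl : p ∈ closure (U : Set 𝒟'.carrier) := by
      rw [mem_closure_iff_nhds]
      intro V hV
      obtain ⟨a, haU, haV, -⟩ := hN V hV univ univ_mem
      exact ⟨a, haV, haU⟩
    have hpfr : p ∈ frontier (U : Set 𝒟'.carrier) := by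
      refine ⟨hpcl, ?_⟩
      rw [U.isOpen.interior_eq]
      exact hp
    refine hncb p hpfr q (clusterPt_iff_nonempty.2 fun W' hW' A hA ↦ ?_)
    obtain ⟨V, hV, hVU⟩ := mem_nhdsWithin_iff_exists_mem_nhds_inter.1 (mem_map.1 hA)
    obtain ⟨a, haU, haV, haW'⟩ := hN V hV W' hW'
    exact ⟨ψ a, haW', hVU ⟨haV, haU⟩⟩

/-- **The relative glued space is Hausdorff when `U` has no corresponding boundary points**
(`SmoothGlueData.t2Space_of_isClosed_graph` with `isClosed_graph_of_ncb`; relative form of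
`CommonDevelopment.t2Space_glued`, Sbierski 2016, §3.3, "`M̃` is indeed Hausdorff"). -/
theorem t2Space_glued_of_ncb {𝒟' : CauchyDevelopment D₁} {𝒟 : CauchyDevelopment D₂}
    {U : Opens 𝒟'.carrier} {ψ : 𝒟'.carrier → 𝒟.carrier} (hcont : ContinuousOn ψ U)
    (hncb : ∀ p ∈ frontier (U : Set 𝒟'.carrier), ∀ q : 𝒟.carrier,
      ¬ ClusterPt q (map ψ (𝓝[(U : Set 𝒟'.carrier)] p)))
    (d : SmoothGlueData (𝓡 (n + 1)) (𝓡 (n + 1)) 𝒟'.carrier 𝒟.carrier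
      (EuclideanSpace ℝ (Fin (n + 1))))
    (hsrc : d.glue.source = (U : Set 𝒟'.carrier)) (hglue : ∀ p (hp : p ∈ U), d.glue p = ψ p) :
    T2Space d.Glued :=
  d.t2Space_of_isClosed_graph (isClosed_graph_of_ncb hcont hncb d hsrc hglue)

/-! ### Elementary identities of the glued space -/

/-- **The identification**: `π j' p = π j q` iff `p ∈ U` and `ψ p = q`. -/
theorem inl_eq_inr_iff' {𝒟' : CauchyDevelopment D₁} {𝒟 : CauchyDevelopment D₂}
    {U : Opens 𝒟'.carrier} {ψ : 𝒟'.carrier → 𝒟.carrier}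
    (d : SmoothGlueData (𝓡 (n + 1)) (𝓡 (n + 1)) 𝒟'.carrier 𝒟.carrier
      (EuclideanSpace ℝ (Fin (n + 1))))
    (hsrc : d.glue.source = (U : Set 𝒟'.carrier)) (hglue : ∀ p (hp : p ∈ U), d.glue p = ψ p)
    {p : 𝒟'.carrier} {q : 𝒟.carrier} :
    d.inl p = d.inr q ↔ p ∈ U ∧ ψ p = q := by
  rw [d.inl_eq_inr_iff, hsrc]
  constructor
  · rintro ⟨hp, h⟩
    exact ⟨hp, by rw [← hglue _ hp]; exact h⟩
  · rintro ⟨hp, h⟩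
    exact ⟨hp, by rw [hglue _ hp]; exact h⟩

/-- `π j (ψ p) = π j' p` for `p ∈ U`. -/
theorem inr_apply_eq_inl {𝒟' : CauchyDevelopment D₁} {𝒟 : CauchyDevelopment D₂}
    {U : Opens 𝒟'.carrier} {ψ : 𝒟'.carrier → 𝒟.carrier}
    (d : SmoothGlueData (𝓡 (n + 1)) (𝓡 (n + 1)) 𝒟'.carrier 𝒟.carrier
      (EuclideanSpace ℝ (Fin (n + 1))))
    (hsrc : d.glue.source = (U : Set 𝒟'.carrier)) (hglue : ∀ p (hp : p ∈ U), d.glue p = ψ p)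
    {p : 𝒟'.carrier} (hp : p ∈ U) : d.inr (ψ p) = d.inl p :=
  ((inl_eq_inr_iff' d hsrc hglue).2 ⟨hp, rfl⟩).symm

/-- **The two data embeddings agree in the glued space over `Φ`**: `π j' (ι' u) = π j (ι (Φ u))`
(`ι'(N) ⊆ U` and `ψ ∘ ι' = ι ∘ Φ`). -/
theorem inl_embed_eq_inr_embed' {𝒟' : CauchyDevelopment D₁} {𝒟 : CauchyDevelopment D₂}
    {Φ : N → X} {U : Opens 𝒟'.carrier} {ψ : 𝒟'.carrier → 𝒟.carrier}
    (hι : ∀ u, 𝒟'.embed u ∈ U) (hc : ψ ∘ 𝒟'.embed = 𝒟.embed ∘ Φ)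
    (d : SmoothGlueData (𝓡 (n + 1)) (𝓡 (n + 1)) 𝒟'.carrier 𝒟.carrier
      (EuclideanSpace ℝ (Fin (n + 1))))
    (hsrc : d.glue.source = (U : Set 𝒟'.carrier)) (hglue : ∀ p (hp : p ∈ U), d.glue p = ψ p)
    (u : N) : d.inl (𝒟'.embed u) = d.inr (𝒟.embed (Φ u)) :=
  (inl_eq_inr_iff' d hsrc hglue).2 ⟨hι u, congrFun hc u⟩

/-- The overlap `π j'(U) = π j'(M') ∩ π j(M)`. -/
theorem range_inl_comp_subtypeVal' {𝒟' : CauchyDevelopment D₁} {𝒟 : CauchyDevelopment D₂}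
    {U : Opens 𝒟'.carrier}
    (d : SmoothGlueData (𝓡 (n + 1)) (𝓡 (n + 1)) 𝒟'.carrier 𝒟.carrier
      (EuclideanSpace ℝ (Fin (n + 1))))
    (hsrc : d.glue.source = (U : Set 𝒟'.carrier)) :
    range (d.inl ∘ (Subtype.val : U → 𝒟'.carrier)) = range d.inl ∩ range d.inr := by
  ext p
  constructor
  · rintro ⟨y, rfl⟩
    refine ⟨⟨y.1, rfl⟩, ?_⟩
    exact d.inl_mem_range_inr_iff.2 (by rw [hsrc]; exact y.2)
  · rintro ⟨⟨a, rfl⟩, ha⟩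
    have ha' : a ∈ U := by
      have h := d.inl_mem_range_inr_iff.1 ha
      rw [hsrc] at h
      exact h
    exact ⟨⟨a, ha'⟩, rfl⟩

/-- The glued space is connected: the union of the connected images of `M'` and `M`, which meet
(at the image of `ι'(N)`, `N ≠ ∅`). -/
theorem connectedSpace_glued' {𝒟' : CauchyDevelopment D₁} {𝒟 : CauchyDevelopment D₂}
    {U : Opens 𝒟'.carrier} {ψ : 𝒟'.carrier → 𝒟.carrier} (hι : ∀ u, 𝒟'.embed u ∈ U)
    (d : SmoothGlueData (𝓡 (n + 1)) (𝓡 (n + 1)) 𝒟'.carrier 𝒟.carrier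
      (EuclideanSpace ℝ (Fin (n + 1))))
    (hsrc : d.glue.source = (U : Set 𝒟'.carrier)) (hglue : ∀ p (hp : p ∈ U), d.glue p = ψ p) :
    ConnectedSpace d.Glued := by
  obtain ⟨x⟩ : Nonempty N := inferInstance
  rw [connectedSpace_iff_univ, ← d.range_inl_union_range_inr]
  refine (isConnected_range d.continuous_inl).union ⟨d.inl (𝒟'.embed x), ⟨_, rfl⟩, ?_⟩
    (isConnected_range d.continuous_inr)
  exact ⟨ψ (𝒟'.embed x), inr_apply_eq_inl d hsrc hglue (hι x)⟩

/-- The quotient map `M' ⊔ M → M̃` is open, hence the glued space is second countable. -/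
theorem secondCountableTopology_glued' {𝒟' : CauchyDevelopment D₁} {𝒟 : CauchyDevelopment D₂}
    (d : SmoothGlueData (𝓡 (n + 1)) (𝓡 (n + 1)) 𝒟'.carrier 𝒟.carrier
      (EuclideanSpace ℝ (Fin (n + 1)))) :
    SecondCountableTopology d.Glued :=
  SmoothGlueData.secondCountableTopology_of_pieces d

end SubdataDevelopmentsEmbed

end Summit.FinalStateConjecture.FinalStateConjecture.Theorems

end
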